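/-
Copyright (c) 2026 the pub-hodgecm-mathlib formalisation cell (harness21).  Prover seat hodgecm-mathlib-K2E3-p17 (g11), HCML Track B «K2-LIT» ∕ h413
(`stmt-HodgeConjecture-24833`), R90-TF section S3, (U3-F) assembly layer B1 «generators are dense» (captain's skeleton
`R90/S3/SKELETON-P8-AuxGlobaliseField.K2E3-p17-g11.md` 941dd0e5, step B1).  2026-09-05.
-/
import Mathlib.NumberTheory.Padics.PadicNumbers
import Mathlib.FieldTheory.PrimitiveElement
import Mathlib.Topology.Algebra.Module.FiniteDimension
import HarnessLib

/-!
# R90-TF · S3 · THEOREMS — `R90S3GeneratorInOpen` ((U3-F) assembly, layer B1): in a finite extension `K` of `ℚ_p` with its vector-space topology, EVERY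
# non-empty open set contains a GENERATOR `y` (`ℚ_p⟮y⟯ = ⊤`)

R90-TF section S3 (dealer R90-C12-plan (g2)); crux H413 (`stmt-HodgeConjecture-24833`, lane `--supports … --as helper`), route `HCCMUnconditional`.  Serves step B2 of
the (U3-F) assembly (`stub_R90_S3_auxGlobaliseField`): the p-adic planting target needs a GENERATOR `y` of `K = L⁺_v` over `ℚ_p` lying in a prescribed SQUARE CLASS
(an open set, ★ P2″ `R90S3KrasnerTransportToCompletion.exists_radius_sq_class`) and in a prescribed ball (`v(y) > 0`); this file shows such a `y` exists in any
non-empty open set.  PURE MATHLIB; THEOREMS ONLY (no `def`, no `instance`, no notation, no named fact, no `sorry`); never imports `Cruxes/…/Lines`.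

THE MATHEMATICS [folklore; Neukirch II (8.2)–(8.4) uses it tacitly].  `K ∕ ℚ_p` finite (hence separable) has a primitive element, so only FINITELY many intermediate
fields (Mathlib `Field.finite_intermediateField_of_exists_primitive_element`).  An element `y` fails to generate iff it lies in a PROPER intermediate field
(namely `ℚ_p⟮y⟯`).  In the topology of a Hausdorff topological `ℚ_p`-vector space structure on `K`, each proper intermediate field is a finite-dimensional, hence
CLOSED, `ℚ_p`-subspace (Mathlib `Submodule.closed_of_finiteDimensional`) with EMPTY INTERIOR (Mathlib `Submodule.eq_top_of_nonempty_interior'`), and a finite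
union of closed sets with empty interior has empty interior (Mathlib `interior_union_isClosed_of_interior_empty`, by induction).  So the non-generators have empty
interior, i.e. every non-empty open set contains a generator.
* §1 `interior_biUnion_finset_eq_empty` — finite unions of closed sets with empty interior.
* §2 `isClosed_intermediateField`, `interior_intermediateField_eq_empty` (proper ones), **`exists_mem_adjoin_eq_top_of_isOpen`** (the head).

HONEST LABEL: HC_CM is proved only modulo the 7 printed citations (2 remaining named inputs: hLiu418 = stmt-HodgeConjecture-24832, h413 =
stmt-HodgeConjecture-24833) until rung 0 closes; elementary topology∕field theory for a sub-step of a GENUINE residual ((U3-F)); proves nothing printed; count-neutral.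
References: [NeukirchANT1999] Ch. II (8.2)–(8.4); [Serre1979] Ch. II §5 (topology of finite extensions of local fields).
-/

set_option autoImplicit false
-- the mandated namespace repeats the single-problem summit's segment (`HodgeConjecture.HodgeConjecture`)
set_option linter.dupNamespace false

noncomputable section

namespace Summit.HodgeConjecture.HodgeConjecture.R90.S3

open IntermediateField Topology

/-! ## §1 Finite unions of closed sets with empty interior -/

/-- A finite union of closed sets with empty interior has empty interior (induction on Mathlib `interior_union_isClosed_of_interior_empty`). [folklore] -/
theorem interior_biUnion_finset_eq_empty {X : Type*} [TopologicalSpace X] {ι : Type*} (s : Finset ι) (f : ι → Set X)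
    (hc : ∀ i ∈ s, IsClosed (f i)) (hi : ∀ i ∈ s, interior (f i) = ∅) : interior (⋃ i ∈ s, f i) = ∅ := by
  classical
  induction s using Finset.induction_on with
  | empty => simp
  | @insert a s ha ih =>
    rw [Finset.set_biUnion_insert,
      interior_union_isClosed_of_interior_empty (hc a (Finset.mem_insert_self a s))
        (ih (fun i hi' => hc i (Finset.mem_insert_of_mem hi')) fun i hi' => hi i (Finset.mem_insert_of_mem hi'))]
    exact hi a (Finset.mem_insert_self a s)

/-! ## §2 Proper intermediate fields are closed with empty interior; generators are dense -/

section Padic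

variable (p : ℕ) [Fact p.Prime] {K : Type*} [Field K] [Algebra ℚ_[p] K] [FiniteDimensional ℚ_[p] K]
  [TopologicalSpace K] [IsTopologicalRing K] [T2Space K] [ContinuousSMul ℚ_[p] K]

/-- An intermediate field of the finite extension `K ∕ ℚ_p` is a CLOSED subset (a finite-dimensional subspace of a Hausdorff topological `ℚ_p`-vector space,
Mathlib `Submodule.closed_of_finiteDimensional`). [cite: Serre1979, Ch. II §5] -/
theorem isClosed_intermediateField (F : IntermediateField ℚ_[p] K) : IsClosed (F : Set K) := by
  have h : IsClosed ((F.toSubalgebra.toSubmodule : Submodule ℚ_[p] K) : Set K) := Submodule.closed_of_finiteDimensional _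
  exact h

omit [FiniteDimensional ℚ_[p] K] [T2Space K] in
/-- A PROPER intermediate field of `K ∕ ℚ_p` has EMPTY INTERIOR (Mathlib `Submodule.eq_top_of_nonempty_interior'`: a subspace with an interior point is everything).
[cite: Serre1979, Ch. II §5] -/
theorem interior_intermediateField_eq_empty {F : IntermediateField ℚ_[p] K} (hF : F ≠ ⊤) : interior (F : Set K) = ∅ := by
  by_contra hne
  apply hF
  have hne' : (interior ((F.toSubalgebra.toSubmodule : Submodule ℚ_[p] K) : Set K)).Nonempty := Set.nonempty_iff_ne_empty.2 hne
  have htop : (F.toSubalgebra.toSubmodule : Submodule ℚ_[p] K) = ⊤ := Submodule.eq_top_of_nonempty_interior' _ hne'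
  refine eq_top_iff.2 fun x _ => ?_
  have hx : x ∈ (F.toSubalgebra.toSubmodule : Submodule ℚ_[p] K) := by rw [htop]; exact Submodule.mem_top
  exact hx

/-- **Generators are dense**: every non-empty open subset of `K` contains `y` with `ℚ_p⟮y⟯ = ⊤` (the non-generators lie in the finitely many proper intermediate
fields — Mathlib `Field.finite_intermediateField_of_exists_primitive_element` — each closed with empty interior). [cite: NeukirchANT1999, Ch. II (8.2)]
[cite: Serre1979, Ch. II §5] -/
theorem exists_mem_adjoin_eq_top_of_isOpen {U : Set K} (hU : IsOpen U) (hne : U.Nonempty) : ∃ y ∈ U, ℚ_[p]⟮y⟯ = ⊤ := by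
  classical
  haveI : Finite (IntermediateField ℚ_[p] K) :=
    Field.finite_intermediateField_of_exists_primitive_element ℚ_[p] K (Field.exists_primitive_element ℚ_[p] K)
  haveI : Fintype (IntermediateField ℚ_[p] K) := Fintype.ofFinite _
  by_contra h
  push Not at h
  -- `U` is contained in the union of the proper intermediate fields
  set S : Finset (IntermediateField ℚ_[p] K) := Finset.univ.filter fun F => F ≠ ⊤ with hS
  have hsub : U ⊆ ⋃ F ∈ S, (F : Set K) := by
    intro y hy
    refine Set.mem_iUnion₂.2 ⟨ℚ_[p]⟮y⟯, ?_, mem_adjoin_simple_self ℚ_[p] y⟩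
    rw [hS, Finset.mem_filter]
    exact ⟨Finset.mem_univ _, h y hy⟩
  -- whose interior is empty
  have hint : interior (⋃ F ∈ S, (F : Set K)) = ∅ :=
    interior_biUnion_finset_eq_empty S (fun F => (F : Set K)) (fun F _ => isClosed_intermediateField p F) fun F hF => by
      rw [hS, Finset.mem_filter] at hF
      exact interior_intermediateField_eq_empty p hF.2
  -- contradiction: `U ⊆ interior (⋃ …) = ∅`
  have hU' : U ⊆ interior (⋃ F ∈ S, (F : Set K)) := interior_maximal hsub hU
  rw [hint] at hU'
  exact Set.not_nonempty_empty (hne.mono hU')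

end Padic

end Summit.HodgeConjecture.HodgeConjecture.R90.S3

end
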